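import Summits.FinalStateConjecture.FinalStateConjecture.Theses.MergerLatticeBudget
import Summits.FinalStateConjecture.FinalStateConjecture.Theses.QuietWindowCapture
import Literature.Geometry.Lorentzian.SoundNearKerrLeaf
import Literature.Geometry.Lorentzian.LocatedLeaf
import HarnessLib.Audit

/-!
# Birth skeleton (BC3) — crux `QuietLeaves` (stmt-FinalStateConjecture-10114 / -10910)

Registrar: planner-skel-stmt-FinalStateConjecture-10114-0, 2026-08-17 (route re-audit bin
REPAIRABLE; published as `Cruxes/QuietLeaves/Lines/birth.lean`).  The crux is FIXED and concluded
BY NAME.  The crux directory `Cruxes/QuietLeaves` is shared by two statement items with the same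
decl name:

* `Summit.FinalStateConjecture.FinalStateConjecture.Theses.MergerLatticeBudget.QuietLeaves`
  (stmt-FinalStateConjecture-10910, the payload route `route-FinalStateConjecture-MergerLatticeBudget`,
  rev ≥ 3: the shared leaf block WITH the phantom-hole repair C′, per-hole clause `2·Mᵢ ≤ Rᵢ`) —
  concluded by `QuietLeaves_of`;
* `Summit.FinalStateConjecture.FinalStateConjecture.Theses.QuietWindowCapture.QuietLeaves`
  (stmt-FinalStateConjecture-10114, the payload item; route QuietWindowCapture, rev-1 block without
  the C′ clause) — concluded by `QuietLeaves_QWC_of` from the SAME two stubs (the rev-3 block implies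
  the rev-1 block conjunct-wise).

## The cut (two named stubs, composition kernel-checked)

`QuietLeaves` = recurrence of every complete-`𝓘⁺` MGHD of admissible data to the Kerr FAMILY along
`(ε,k)`-near-Kerr leaves beyond every compact set, with a UNIFORM census: `N ≤ N₀` holes of masses in
`[m₀, 1/m₀]`.  The two contents the groundings / retriages of the item name separately
(grounder g18-8: "GR analogue of soliton resolution along a sequence of times"; retriage-QWC-g2:
"windowed quantitative no-hair … + finitely many late holes of mass ≥ m₀") are cut apart, and the
hand-over object is the tree's REPAIRED leaf predicate `CauchyDevelopment.IsSoundNearKerrLeaf`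
(`Literature/Geometry/Lorentzian/SoundNearKerrLeaf.lean`: the typed block + (S₁) thick honest discs
`2Mᵢ ≤ Rᵢ`, (S₂)/(S₃) LAYER certification of hole and flat charts, (S₄) flat-frame tube separation,
(S₅) achronal flat sheet), so that neither stub can be met by the catalogued junk of the typed block
(dodging sheets `NearKerrLeafMinkowski{Dodge,Boosted,BoostedDodge}`, fake/phantom holes
`NearKerrLeafMinkowskiFakeHoles`, evidence note `note-leaf-dodge.md` on stmt-10114):

* `stub_soundRecurrence` (XL, open-problem — THE LOAD-BEARING STUB: dissipation budget at `𝓘⁺ ∪ 𝓗⁺`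
  + windowed quantitative no-hair / two-boundary observability + far-field exterior stability):
  every MGHD with complete `𝓘⁺` of an admissible datum contains, for every `k`, every `ε > 0` and
  beyond every compact `K`, a SOUND `(ε,k)`-near-Kerr leaf with SOME number of holes and SOME
  labels — recurrence to the Kerr family, census neither capped nor floored.
* `stub_lateCensus` (L/open — finitely many macroscopic late holes): for every such MGHD there are
  `N₀`, `m₀ > 0`, a fineness threshold `(k₁, ε₁)` and a compact `K₀` such that EVERY sound leaf
  beyond `K₀` at fineness `k ≥ k₁`, `ε ≤ ε₁` has `N ≤ N₀` holes, all of masses in `[m₀, 1/m₀]`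
  (a universal property of honest late leaves: the sound clauses make every label a genuine
  strong-field Kerr-like region met by the entire achronal sheet, so the statement is "no unbounded
  proliferation / no cascade of ever smaller late black holes, and no label above the energy scale",
  not a statement about typing artefacts; coarse leaves are exempt because `ε ≳ 1` certifies nothing).

`QuietLeaves_of : stub₁-sig → stub₂-sig → MergerLatticeBudget.QuietLeaves` is PROVED below (choose the
leaf of `stub_soundRecurrence` at fineness `(max k k₁, min ε ε₁)` beyond `K ∪ K₀`, read its census
through `stub_lateCensus`, lower the fineness by `IsSoundNearKerrLeaf.mono`, shrink the compact set by
`causalPast_mono`, and project sound ⇒ thick typed block ⇒ typed block).  `lean check`: sorries ONLY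
in the two `stub_*`.

Disproof used: none exists for this crux (no `Cruxes/QuietLeaves/Disproof.lean`; payload
`disproof_path` absent, 2026-08-17).  Negative knowledge honoured: the evidence note
`note-leaf-dodge.md` (lead 10807-c2) — "items concluding ∃ near-Kerr leaf are junk-satisfiable on
paper" — is exactly why the stubs hand over SOUND leaves (achronal sheet, layer certification,
`2M ≤ R`), on which the dodge and the fake holes are dead (`SoundNearKerrLeaf.lean`, module docstring).
-/

noncomputable section

open scoped Manifold ContDiff Topology ENNReal
open Filter Set TopologicalSpace Literature.Geometry.Lorentzian

namespace Summit.FinalStateConjecture.FinalStateConjecture.Cruxes.QuietLeaves.Birth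

set_option linter.dupNamespace false
set_option linter.unusedVariables false

section ThickLeaf

variable {X : Type} [TopologicalSpace X] [ChartedSpace E3 X] [IsManifold (𝓡 3) ∞ X]
  [ConnectedSpace X] {D : InitialDataSet (𝓡 3) X}

/-- **Thick typed leaf** = the leaf block of route `MergerLatticeBudget` (rev ≥ 3, phantom repair C′):
the block of `CauchyDevelopment.IsNearKerrLeaf` VERBATIM as inlined in the route items (anonymous
`ModelBackground` constructors, `Summit.FinalStateConjecture.exteriorOf`), with the per-hole clause
extended by `2 * M i ≤ R i`.  Token-identical to the `∃`-block of
`Theses.MergerLatticeBudget.QuietLeaves`, so the hand-over to the crux is definitional. -/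
def IsThickNearKerrLeaf (𝒟 : CauchyDevelopment D) (k : ℕ) (ε : ℝ≥0∞) (N : ℕ) (M a : Fin N → ℝ)
    (S : Set 𝒟.carrier) : Prop :=
  ∃ (R ρ : Fin N → ℝ) (mo : Fin N → lorentzGroup × E4) (r : Fin N → E4 → ℝ)
    (B : Fin N → ModelBackground) (U₀ : TopologicalSpace.Opens E4) (B₀ : ModelBackground)
    (Ψ : ∀ i, (B i).domain → 𝒟.carrier) (Ψ₀ : B₀.domain → 𝒟.carrier)
    (L W : ∀ i, Set (B i).domain) (L₀ W₀ : Set B₀.domain),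
    (∀ i, r i = fun x => Kerr.radius (a i) (poincareInv (mo i).1 (mo i).2 x)) ∧
    (∀ i, B i = (⟨⟨poincareInv (mo i).1 (mo i).2 ⁻¹' (Kerr.region (a i) (M i) : Set E4),
      (Kerr.region (a i) (M i)).isOpen.preimage (continuous_poincareInv (mo i).1 (mo i).2)⟩,
      boostedKerrBilin (mo i).1 (mo i).2 (M i) (a i), fun x => poincareInv (mo i).1 (mo i).2 x 0,
      r i⟩ : ModelBackground)) ∧
    B₀ = (⟨U₀, fun _ => Minkowski.bilin, fun x => x 0 - Real.sqrt (1 + E4.spatialNorm x ^ 2),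
      E4.spatialNorm⟩ : ModelBackground) ∧
    (∀ i, L i = {x | -1 < (B i).time x.1 ∧ (B i).time x.1 < 1 ∧ (B i).radius x.1 < R i + 1} ∧
      W i = {x | 0 < (B i).time x.1 ∧ (B i).time x.1 < 1 ∧ (B i).radius x.1 ≤ R i}) ∧
    L₀ = {x | -1 < B₀.time x.1 ∧ B₀.time x.1 < 1} ∧
    W₀ = {x | 0 < B₀.time x.1 ∧ B₀.time x.1 < 1} ∧
    (∀ i, 0 < M i ∧ |a i| ≤ M i ∧ 0 < ρ i ∧ ρ i < R i ∧ 2 * M i ≤ R i) ∧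
    {x : E4 | -1 < x 0 - Real.sqrt (1 + E4.spatialNorm x ^ 2) ∧ ∀ i, ρ i < r i x} ⊆
      (U₀ : Set E4) ∧
    (∀ i, ContMDiffOn 𝓘(ℝ, E4) (𝓡 4) ∞ (Ψ i) (L i) ∧
      Topology.IsOpenEmbedding ((L i).restrict (Ψ i)) ∧
      Ψ i '' L i ⊆ 𝒟.metric.causalFuture 𝒟.timeOrientation (Set.range 𝒟.embed)) ∧
    ContMDiffOn 𝓘(ℝ, E4) (𝓡 4) ∞ Ψ₀ L₀ ∧ Topology.IsOpenEmbedding (L₀.restrict Ψ₀) ∧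
    Ψ₀ '' L₀ ⊆ 𝒟.metric.causalFuture 𝒟.timeOrientation (Set.range 𝒟.embed) ∧
    (∀ i, 𝒟.toSpacetime.truncDeviationCk (B i) (Ψ i) k (R i) 0 ≤ ε) ∧
    𝒟.toSpacetime.deviationCk B₀ Ψ₀ k 0 ≤ ε ∧
    Pairwise (Function.onFun Disjoint fun i => Ψ i '' {x | x ∈ L i ∧ (B i).radius x.1 ≤ R i}) ∧
    (∀ i, Ψ i '' {x | (B i).time x.1 = 0 ∧ ρ i < (B i).radius x.1 ∧ (B i).radius x.1 ≤ R i} ⊆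
      Ψ₀ '' L₀) ∧
    (∀ i, Ψ₀ '' {x | B₀.time x.1 = 0 ∧ ρ i < r i x.1 ∧ r i x.1 < R i} ⊆ Ψ i '' L i) ∧
    S = Ψ₀ '' B₀.timeSlab 0 ∪ ⋃ i, Ψ i '' (B i).truncTimeSlab (R i) 0 ∧
    Ψ₀ '' W₀ ∪ ⋃ i, Ψ i '' W i ⊆ 𝒟.metric.chronologicalFuture 𝒟.timeOrientation S ∧
    Summit.FinalStateConjecture.exteriorOf 𝒟 (Ψ₀ '' W₀ ∪ ⋃ i, Ψ i '' W i) \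
        (Ψ₀ '' W₀ ∪ ⋃ i, Ψ i '' W i) ⊆
      𝒟.metric.causalPast 𝒟.timeOrientation S

/-- **Sound ⇒ thick typed**: a sound leaf is a leaf of the `MergerLatticeBudget` block, same charts
(projection onto the twenty typed clauses, the per-hole clause enriched by (S₁) `2Mᵢ ≤ Rᵢ`;
`starBackground`, `hypBackground`, `CauchyDevelopment.exteriorOf` unfold definitionally to the
inlined forms). -/
theorem isThickNearKerrLeaf_of_sound {𝒟 : CauchyDevelopment D} {k : ℕ} {ε : ℝ≥0∞} {N : ℕ}
    {M a : Fin N → ℝ} {S : Set 𝒟.carrier} (h : 𝒟.IsSoundNearKerrLeaf k ε N M a S) :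
    IsThickNearKerrLeaf 𝒟 k ε N M a S := by
  obtain ⟨R, ρ, mo, r, B, U₀, B₀, Ψ, Ψ₀, L, W, L₀, W₀, h1, h2, h3, h4, h5, h6, h7, h8, h9, h10, h11,
    h12, h13, h14, h15, h16, h17, h18, h19, h20, hS1, -⟩ := h
  exact ⟨R, ρ, mo, r, B, U₀, B₀, Ψ, Ψ₀, L, W, L₀, W₀, h1, h2, h3, h4, h5, h6,
    fun i ↦ ⟨(h7 i).1, (h7 i).2.1, (h7 i).2.2.1, (h7 i).2.2.2, hS1 i⟩, h8, h9, h10, h11,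
    h12, h13, h14, h15, h16, h17, h18, h19, h20⟩

/-- **Thick typed ⇒ typed**: dropping (S₁) gives the rev-1 block `CauchyDevelopment.IsNearKerrLeaf`
(route `QuietWindowCapture`), same charts. -/
theorem isNearKerrLeaf_of_thick {𝒟 : CauchyDevelopment D} {k : ℕ} {ε : ℝ≥0∞} {N : ℕ}
    {M a : Fin N → ℝ} {S : Set 𝒟.carrier} (h : IsThickNearKerrLeaf 𝒟 k ε N M a S) :
    𝒟.IsNearKerrLeaf k ε N M a S := by
  obtain ⟨R, ρ, mo, r, B, U₀, B₀, Ψ, Ψ₀, L, W, L₀, W₀, h1, h2, h3, h4, h5, h6, h7, h8, h9, h10, h11,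
    h12, h13, h14, h15, h16, h17, h18, h19, h20⟩ := h
  exact ⟨R, ρ, mo, r, B, U₀, B₀, Ψ, Ψ₀, L, W, L₀, W₀, h1, h2, h3, h4, h5, h6,
    fun i ↦ ⟨(h7 i).1, (h7 i).2.1, (h7 i).2.2.1, (h7 i).2.2.2.1⟩, h8, h9, h10, h11,
    h12, h13, h14, h15, h16, h17, h18, h19, h20⟩

end ThickLeaf

/-! ## The two registered stubs -/

/-- **Registered stub 1 — sound recurrence to the Kerr family** (XL, open problem; THE
LOAD-BEARING STUB).  For every admissible datum and every MGHD `𝒟` with complete `𝓘⁺`: for every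
order `k`, every tolerance `ε > 0` and every compact `K ⊆ 𝒟` there is a SOUND `(ε,k)`-near-Kerr leaf
`S` of `𝒟` disjoint from `J⁻(K)`, with some number `N` of holes and some labels `(Mᵢ, aᵢ)` — the
typed block plus thick honest discs `2Mᵢ ≤ Rᵢ`, `Cᵏ` certification of every hole chart on its whole
near-zone layer and of the flat chart on its whole hyperboloidal layer, flat-frame tube separation,
and an ACHRONAL flat sheet (`CauchyDevelopment.IsSoundNearKerrLeaf`).  Intended proof (card
dissipation-budget-quiet-window-capture, items B1+B2, QR, FarField; route QuietWindowCapture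
TWO-LAYER PLAN `DissipationBudget → QuantitativeNoHair`): (i) the Bondi rest mass of the cuts
`∂J⁺(C) ∩ 𝓘⁺` is non-increasing in the causal order of late compact `C` and bounded below, the total
event-horizon area is non-decreasing and bounded (`CutBondiMass`, `EventHorizonArea(Law)`,
`HorizonLineage` carriers), so for every `δ` and every window length `T` some late window radiates
`< δ` through `𝓘⁺` AND absorbs `< δ` through `𝓗⁺`; (ii) WINDOWED QUANTITATIVE NO-HAIR (the open
core): a vacuum region `δ(ε,k,T)`-quiet through both boundaries over a window of length
`T ≳ log(1/ε)` is, on a mid-window hyperboloidal slab, `ε`-close in `Cᵏ` to finitely many boosted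
Kerr star regions plus flat far field (linear archetype: exterior energy channels / two-boundary
observability for Teukolsky on sub-extremal Kerr, real-axis mode stability arXiv:2007.07211,
arXiv:2302.08916; channels arXiv:1912.07664, arXiv:2211.16075; exact-zero-flux rigidity near `𝓘`:
Alexakis–Schlue 2018, Ionescu–Klainerman / AIK near-Kerr rigidity); (iii) the far field of the leaf
(entire achronal `ε`-flat hyperboloidal sheet reaching the cut) by exterior stability of the
radiation zone (Klainerman–Nicolò 2003, Ch. 3; Christodoulou–Klainerman 1993, Ch. 17), which is
where the admissible `o₂/o₁` tails must be shown not to spoil `Cᵏ` fineness ON the sheet (the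
item's recorded ∀k-exposure).  Why it might fail: (ii) is conjectural even for the linearised
problem with derivative loss from trapping; rough admissible far tails may keep late `Cᵏ` sup norms
large for `k ≥ 2` (retriage-QWC-0) — then the crux itself is misstated (repair recorded in both route
headers: data smooth at infinity to all orders); eternal radiators / vacuum breathers would refute it
outright (kill criterion of both routes).  Sources: arXiv:1912.07664, arXiv:2211.16075,
arXiv:2007.07211, arXiv:2302.08916, arXiv:gr-qc/0001003, AlexakisSchlue2018,
AlexakisIonescuKlainerman2010, ChristodoulouKlainerman1993, DafermosHolzegelRodnianskiTaylor2021 §1. -/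
theorem stub_soundRecurrence :
  ∀ (X : Type) [TopologicalSpace X] [ChartedSpace E3 X] [IsManifold (𝓡 3) ∞ X] [T2Space X]
    [SecondCountableTopology X] [ConnectedSpace X] (D : InitialDataSet (𝓡 3) X),
    D ∈ admissibleVacuumData X → ∀ 𝒟 : VacuumCauchyDevelopment D, 𝒟.IsMaximal →
    Summit.FinalStateConjecture.HasCompleteNullInfinity 𝒟.toCauchyDevelopment →
    ∀ (k : ℕ) (ε : ℝ≥0∞), 0 < ε → ∀ K : Set 𝒟.carrier, IsCompact K →
      ∃ (N : ℕ) (M a : Fin N → ℝ) (S : Set 𝒟.carrier),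
        Disjoint S (𝒟.metric.causalPast 𝒟.timeOrientation K) ∧
        𝒟.toCauchyDevelopment.IsSoundNearKerrLeaf k ε N M a S := by
  sorry

/-- **Registered stub 2 — the late census is bounded** (L / open: finitely many macroscopic late
holes, mass floor and ceiling).  For every admissible datum and every MGHD `𝒟` with complete `𝓘⁺`
there are a cap `N₀`, a floor `m₀ > 0`, a fineness threshold `(k₁, ε₁)`, `ε₁ > 0`, and a compact
`K₀ ⊆ 𝒟` such that EVERY sound `(ε,k)`-near-Kerr leaf of `𝒟` with `k ≥ k₁`, `ε ≤ ε₁`, disjoint from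
`J⁻(K₀)`, has `N ≤ N₀` holes, all with `m₀ ≤ Mᵢ ≤ 1/m₀`.  Why plausibly true: on a SOUND fine leaf
every label `i` certifies a genuine Kerr-like strong-field region of mass `Mᵢ (1 ± o(1))` straddling
`r = 2Mᵢ ≥ r₊` (thick discs + layer certification pin the label to the curvature; no phantom, no
flat-charted fake), the near zones are pairwise disjoint in `𝒟` and in the flat frame, and the sheet
is an entire achronal asymptotically hyperboloidal hypersurface met by every black-hole world-tube of
the exterior — so the census of a late fine leaf is the census of black holes of the development at
an outgoing-null epoch: CEILING from the energy scale of the datum (`Mᵢ ≲ E_ADM`, Bondi energy of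
the leaf's cut; `RestMassBudget`-type bookkeeping of route MergerLatticeBudget), CAP AND FLOOR = "no
cascade of ever smaller late black holes": each hole visible at a late leaf persists to all later
leaves (area theorem, arXiv:gr-qc/0001003; HawkingEllis1973 Prop. 9.2.7) and late formation of a
hole of mass `m` costs trapped-surface formation from `≳ m` of late incoming energy, of which only a
finite budget remains.  Why it might fail: admissible large data whose development forms infinitely
many ever-smaller black holes at ever later times (the item's own recorded risk "late small holes
void uniform N₀, m₀"); double charting of one hole at two epochs inside one leaf (believed excluded
topologically by the entire honest sheet — linking number of far spheres — but not proved in the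
tree); labels above `E_ADM` need a quasi-local mass comparison along the sheet (positivity of the
Bondi energy of the cut over `CauchyDevelopment` is not vendored, `CutBondiMass` docstring (iii)).
Sources: arXiv:gr-qc/0001003, HawkingEllis1973, ChristodoulouKlainerman1993 Ch. 17, Christodoulou2008,
arXiv:1601.01871 (resolution along a sequence of times — the shape of the statement), Penrose1973. -/
theorem stub_lateCensus :
  ∀ (X : Type) [TopologicalSpace X] [ChartedSpace E3 X] [IsManifold (𝓡 3) ∞ X] [T2Space X]
    [SecondCountableTopology X] [ConnectedSpace X] (D : InitialDataSet (𝓡 3) X),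
    D ∈ admissibleVacuumData X → ∀ 𝒟 : VacuumCauchyDevelopment D, 𝒟.IsMaximal →
    Summit.FinalStateConjecture.HasCompleteNullInfinity 𝒟.toCauchyDevelopment →
    ∃ (N₀ : ℕ) (m₀ : ℝ) (k₁ : ℕ) (ε₁ : ℝ≥0∞) (K₀ : Set 𝒟.carrier),
      0 < m₀ ∧ 0 < ε₁ ∧ IsCompact K₀ ∧
      ∀ (k : ℕ) (ε : ℝ≥0∞) (N : ℕ) (M a : Fin N → ℝ) (S : Set 𝒟.carrier),
        k₁ ≤ k → ε ≤ ε₁ → Disjoint S (𝒟.metric.causalPast 𝒟.timeOrientation K₀) →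
        𝒟.toCauchyDevelopment.IsSoundNearKerrLeaf k ε N M a S →
        N ≤ N₀ ∧ ∀ i, m₀ ≤ M i ∧ M i ≤ m₀⁻¹ := by
  sorry

/-! ## Registered stub signatures (by name, for `ledger skeleton check` / `#h21_check_skeleton`)

Each `Registered.stub_<name>` is the statement of the theorem `stub_<name>` above, verbatim, so
that the compositions take their hypotheses BY NAME (checked by ascription below). -/
namespace Registered

/-- Registered signature of `stub_soundRecurrence` (verbatim). -/
abbrev stub_soundRecurrence : Prop :=
  ∀ (X : Type) [TopologicalSpace X] [ChartedSpace E3 X] [IsManifold (𝓡 3) ∞ X] [T2Space X]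
    [SecondCountableTopology X] [ConnectedSpace X] (D : InitialDataSet (𝓡 3) X),
    D ∈ admissibleVacuumData X → ∀ 𝒟 : VacuumCauchyDevelopment D, 𝒟.IsMaximal →
    Summit.FinalStateConjecture.HasCompleteNullInfinity 𝒟.toCauchyDevelopment →
    ∀ (k : ℕ) (ε : ℝ≥0∞), 0 < ε → ∀ K : Set 𝒟.carrier, IsCompact K →
      ∃ (N : ℕ) (M a : Fin N → ℝ) (S : Set 𝒟.carrier),
        Disjoint S (𝒟.metric.causalPast 𝒟.timeOrientation K) ∧
        𝒟.toCauchyDevelopment.IsSoundNearKerrLeaf k ε N M a S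

/-- Registered signature of `stub_lateCensus` (verbatim). -/
abbrev stub_lateCensus : Prop :=
  ∀ (X : Type) [TopologicalSpace X] [ChartedSpace E3 X] [IsManifold (𝓡 3) ∞ X] [T2Space X]
    [SecondCountableTopology X] [ConnectedSpace X] (D : InitialDataSet (𝓡 3) X),
    D ∈ admissibleVacuumData X → ∀ 𝒟 : VacuumCauchyDevelopment D, 𝒟.IsMaximal →
    Summit.FinalStateConjecture.HasCompleteNullInfinity 𝒟.toCauchyDevelopment →
    ∃ (N₀ : ℕ) (m₀ : ℝ) (k₁ : ℕ) (ε₁ : ℝ≥0∞) (K₀ : Set 𝒟.carrier),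
      0 < m₀ ∧ 0 < ε₁ ∧ IsCompact K₀ ∧
      ∀ (k : ℕ) (ε : ℝ≥0∞) (N : ℕ) (M a : Fin N → ℝ) (S : Set 𝒟.carrier),
        k₁ ≤ k → ε ≤ ε₁ → Disjoint S (𝒟.metric.causalPast 𝒟.timeOrientation K₀) →
        𝒟.toCauchyDevelopment.IsSoundNearKerrLeaf k ε N M a S →
        N ≤ N₀ ∧ ∀ i, m₀ ≤ M i ∧ M i ≤ m₀⁻¹

end Registered

/-- The registered signatures ARE the statements of the two `stub_*` theorems (checked by
ascription; these `example`s elaborate no `sorry` of their own). -/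
example : Registered.stub_soundRecurrence := stub_soundRecurrence
example : Registered.stub_lateCensus := stub_lateCensus

/-! ## The composition: the crux BY NAME from the two stub statements (no `sorry`) -/

/-- **Sound quiet leaves with a uniform census** — the common core of both compositions: from the
two stubs, every complete-`𝓘⁺` MGHD of an admissible datum has `N₀`, `m₀ > 0` such that for every
`(k, ε, K)` there is a SOUND `(ε,k)`-leaf beyond `J⁻(K)` with `N ≤ N₀` holes of masses in
`[m₀, 1/m₀]`.  Proof: take the leaf of `stub_soundRecurrence` at fineness `(max k k₁, min ε ε₁)`
beyond the compact `K ∪ K₀`; it is beyond `K₀` (`causalPast_mono`), so `stub_lateCensus` bounds its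
census; it is beyond `K`; lower its fineness back to `(k, ε)` by `IsSoundNearKerrLeaf.mono`. -/
theorem soundQuietLeaves (h₁ : Registered.stub_soundRecurrence) (h₂ : Registered.stub_lateCensus) :
  ∀ (X : Type) [TopologicalSpace X] [ChartedSpace E3 X] [IsManifold (𝓡 3) ∞ X] [T2Space X]
    [SecondCountableTopology X] [ConnectedSpace X] (D : InitialDataSet (𝓡 3) X),
    D ∈ admissibleVacuumData X → ∀ 𝒟 : VacuumCauchyDevelopment D, 𝒟.IsMaximal →
    Summit.FinalStateConjecture.HasCompleteNullInfinity 𝒟.toCauchyDevelopment →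
    ∃ (N₀ : ℕ) (m₀ : ℝ), 0 < m₀ ∧ ∀ (k : ℕ) (ε : ℝ≥0∞), 0 < ε → ∀ K : Set 𝒟.carrier,
      IsCompact K → ∃ (N : ℕ) (M a : Fin N → ℝ) (S : Set 𝒟.carrier),
        N ≤ N₀ ∧ (∀ i, m₀ ≤ M i ∧ M i ≤ m₀⁻¹) ∧
        Disjoint S (𝒟.metric.causalPast 𝒟.timeOrientation K) ∧
        𝒟.toCauchyDevelopment.IsSoundNearKerrLeaf k ε N M a S := by
  intro X _ _ _ _ _ _ D hD 𝒟 hmax hscri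
  obtain ⟨N₀, m₀, k₁, ε₁, K₀, hm₀, hε₁, hK₀, hcensus⟩ := h₂ X D hD 𝒟 hmax hscri
  refine ⟨N₀, m₀, hm₀, fun k ε hε K hK ↦ ?_⟩
  obtain ⟨N, M, a, S, hdisj, hleaf⟩ :=
    h₁ X D hD 𝒟 hmax hscri (max k k₁) (min ε ε₁) (lt_min hε hε₁) (K ∪ K₀) (hK.union hK₀)
  have hdisjK : Disjoint S (𝒟.metric.causalPast 𝒟.timeOrientation K) :=
    hdisj.mono_right (LorentzianMetric.causalPast_mono subset_union_left)
  have hdisj₀ : Disjoint S (𝒟.metric.causalPast 𝒟.timeOrientation K₀) :=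
    hdisj.mono_right (LorentzianMetric.causalPast_mono subset_union_right)
  have hb := hcensus (max k k₁) (min ε ε₁) N M a S (le_max_right _ _) (min_le_right _ _) hdisj₀ hleaf
  exact ⟨N, M, a, S, hb.1, hb.2, hdisjK, hleaf.mono (le_max_left _ _) (min_le_left _ _)⟩

set_option maxHeartbeats 1600000 in
/-- **`MergerLatticeBudget.QuietLeaves` from the two stubs, BY NAME** (hypotheses =
`Registered.stub_*`, the verbatim statements of the two `stub_*` theorems): the sound quiet leaves of
`soundQuietLeaves` are thick typed leaves (`isThickNearKerrLeaf_of_sound`), whose block is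
token-identical to the route item's (the hand-over is `exact`). -/
theorem QuietLeaves_of (h₁ : Registered.stub_soundRecurrence) (h₂ : Registered.stub_lateCensus) :
    Theses.MergerLatticeBudget.QuietLeaves := by
  intro X _ _ _ _ _ _ D hD 𝒟 hmax hscri
  obtain ⟨N₀, m₀, hm₀, h⟩ := soundQuietLeaves h₁ h₂ X D hD 𝒟 hmax hscri
  refine ⟨N₀, m₀, hm₀, fun k ε hε K hK ↦ ?_⟩
  obtain ⟨N, M, a, S, hN, hM, hdisj, hleaf⟩ := h k ε hε K hK
  exact ⟨N, M, a, S, hN, hM, hdisj, isThickNearKerrLeaf_of_sound hleaf⟩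

set_option maxHeartbeats 1600000 in
/-- **`QuietWindowCapture.QuietLeaves` (stmt-FinalStateConjecture-10114, rev-1 block) from the SAME
two stubs, BY NAME**: thick typed leaves are typed leaves (`isNearKerrLeaf_of_thick`), and the block of
`CauchyDevelopment.IsNearKerrLeaf` is the route item's block verbatim up to unfolding
`starBackground` / `hypBackground` / `CauchyDevelopment.exteriorOf` (`NearKerrLeaf.lean`, module
docstring), so the hand-over is again `exact`. -/
theorem QuietLeaves_QWC_of (h₁ : Registered.stub_soundRecurrence)
    (h₂ : Registered.stub_lateCensus) : Theses.QuietWindowCapture.QuietLeaves := by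
  intro X _ _ _ _ _ _ D hD 𝒟 hmax hscri
  obtain ⟨N₀, m₀, hm₀, h⟩ := soundQuietLeaves h₁ h₂ X D hD 𝒟 hmax hscri
  refine ⟨N₀, m₀, hm₀, fun k ε hε K hK ↦ ?_⟩
  obtain ⟨N, M, a, S, hN, hM, hdisj, hleaf⟩ := h k ε hε K hK
  exact ⟨N, M, a, S, hN, hM, hdisj, isNearKerrLeaf_of_thick (isThickNearKerrLeaf_of_sound hleaf)⟩

/-- The payload route's version implies the payload item's version (rev-3 block ⇒ rev-1 block),
recorded so that provers of either item see the two crux decls of this directory are ONE target. -/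
theorem quietLeaves_QWC_of_MLB (h : Theses.MergerLatticeBudget.QuietLeaves) :
    Theses.QuietWindowCapture.QuietLeaves := by
  intro X _ _ _ _ _ _ D hD 𝒟 hmax hscri
  obtain ⟨N₀, m₀, hm₀, h⟩ := h X D hD 𝒟 hmax hscri
  refine ⟨N₀, m₀, hm₀, fun k ε hε K hK ↦ ?_⟩
  obtain ⟨N, M, a, S, hN, hM, hdisj, hleaf⟩ := h k ε hε K hK
  exact ⟨N, M, a, S, hN, hM, hdisj,
    isNearKerrLeaf_of_thick (𝒟 := 𝒟.toCauchyDevelopment) hleaf⟩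

end Summit.FinalStateConjecture.FinalStateConjecture.Cruxes.QuietLeaves.Birth

end
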